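import Summits.Ventures.HSemireg.WedgeHankelRecurrenceGaussNewtonStep

/-!
# Venture HSemireg — **THE SYMMETRIC CASE `a ≡ 0`: PARITY `q_n(−x) = (−1)^n q_n(x)` AND SYMMETRIC ZEROS `x_{t−k} = −x_k`** (the recurrence is its own reflection, N324); the zeros sum to
# `0`, `q_n(0) = 0` for odd `n`, and for an odd number of zeros the middle one is `0`

HONEST FRAMING. Part of the Lean index of the computation cell `pub-hsemireg` (seat p10 gen 44, Sunday typer «UNIFORM-IN-n»).  Real polynomials only; no variety, no cohomology theory, no sheaf,
no Ext group and no semiregularity map is constructed here; nothing here says that HC / HC_CM / HC_AV holds; no Literature fact (unproved `Prop`) is declared or used.  Custodian versions as in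
`WedgeHankelSiegelIdeal` (1/3).
SOURCES (cited).  T. S. Chihara, *An Introduction to Orthogonal Polynomials* (1978) Ch. I §4, Thm 4.3 (symmetric OPS: `P_n(−x) = (−1)^n P_n(x)` iff `c_n = 0`); G. Szegő, *Orthogonal Polynomials*,
(2.3.3) and §4.1 (symmetric weights).
PROOF TYPED HERE.  N324 `recurrence_scale_unique` with `c = −1` and `q' = q` (the hypotheses coincide when `a ≡ 0`), evaluated; N324 `recurrence_reflect_zeros` with `q' = q` and N294
`strictMono_eq_of_prod_X_sub_C_eq` for the zeros; N298 `sum_recurrence_zeros` for the sum.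
DEDUP DISCLOSURE (`rg -n 'symmetric|parity|eval_neg' Summits/Ventures/HSemireg`, 2026-09-03): N332 treats the Chebyshev instance (a symmetric recurrence) without stating parity; the general
symmetric case is new.  The 5 names below: 0 hits tree-wide.

WHAT IS IN THE TREE.  N324 `recurrence_scale_unique`, `recurrence_reflect_zeros`; N294 `strictMono_eq_of_prod_X_sub_C_eq`; N298 `sum_recurrence_zeros`.
THIS FILE (namespace `Summit.Ventures.HSemireg.Wedge.HankelOuter` continued; CHAINED on N339 (import only); 0 definitions):
* §1105 **`symmetric_recurrence_parity`** (`q_n = C((−1)^n)·q_n ∘ (−X)`), `symmetric_recurrence_eval_neg` (`q_n(−x) = (−1)^n q_n(x)`), `symmetric_recurrence_eval_zero_odd` (`q_{2s+1}(0) = 0`),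
  **`symmetric_recurrence_zeros_symm`** (`x_k = −x_{t−k}`, `Σ x_k = 0`), `symmetric_recurrence_middle_zero` (`t = 2s` ⇒ `x_s = 0`).
CAVEATS.  `a n = 0` for all `n` (by value); positivity of `b` only for the zero statements.  Nothing Ext-side.  New names only.
-/

open Module Polynomial
open scoped Matrix Polynomial

namespace Summit.Ventures.HSemireg.Wedge.HankelOuter

/-! ## §1105. Symmetric recurrences -/

/-- **PARITY: `q_n = (−1)^n q_n(−X)`** for `a ≡ 0`. [Chihara Ch. I Thm 4.3; this file, §1105] -/
theorem symmetric_recurrence_parity {q : ℕ → ℝ[X]} {a b : ℕ → ℝ} (hq0 : q 0 = 1) (hq1 : q 1 = Polynomial.X - C (a 0))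
    (hrec : ∀ n, q (n + 2) = (Polynomial.X - C (a (n + 1))) * q (n + 1) - C (b (n + 1)) * q n) (ha : ∀ n, a n = 0) (n : ℕ) :
    q n = C ((-1 : ℝ) ^ n) * (q n).comp (C (-1 : ℝ)⁻¹ * Polynomial.X) := by
  refine recurrence_scale_unique hq0 hq1 hrec (by norm_num : (-1 : ℝ) ≠ 0) hq0 (by rw [hq1, ha 0, mul_zero]) (fun k => ?_) n
  rw [hrec k, ha (k + 1), mul_zero]; norm_num

/-- **`q_n(−x) = (−1)^n q_n(x)`** for `a ≡ 0`. [Chihara Ch. I Thm 4.3; Szegő (2.3.3); this file, §1105] -/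
theorem symmetric_recurrence_eval_neg {q : ℕ → ℝ[X]} {a b : ℕ → ℝ} (hq0 : q 0 = 1) (hq1 : q 1 = Polynomial.X - C (a 0))
    (hrec : ∀ n, q (n + 2) = (Polynomial.X - C (a (n + 1))) * q (n + 1) - C (b (n + 1)) * q n) (ha : ∀ n, a n = 0) (n : ℕ) (x : ℝ) :
    (q n).eval (-x) = (-1 : ℝ) ^ n * (q n).eval x := by
  have h := congrArg (fun P : ℝ[X] => P.eval (-x)) (symmetric_recurrence_parity hq0 hq1 hrec ha n)
  simp only [eval_mul, eval_C, eval_comp, eval_X] at h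
  rw [h]; norm_num

/-- **`q_n(0) = 0` for odd `n`** (`a ≡ 0`). [this file, §1105] -/
theorem symmetric_recurrence_eval_zero_odd {q : ℕ → ℝ[X]} {a b : ℕ → ℝ} (hq0 : q 0 = 1) (hq1 : q 1 = Polynomial.X - C (a 0))
    (hrec : ∀ n, q (n + 2) = (Polynomial.X - C (a (n + 1))) * q (n + 1) - C (b (n + 1)) * q n) (ha : ∀ n, a n = 0) (s : ℕ) :
    (q (2 * s + 1)).eval 0 = 0 := by
  have h := symmetric_recurrence_eval_neg hq0 hq1 hrec ha (2 * s + 1) 0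
  rw [neg_zero, pow_succ, pow_mul, neg_one_sq, one_pow, one_mul, neg_one_mul] at h
  linarith

/-- **SYMMETRIC ZEROS: `x_k = −x_{t−k}` for the increasing zeros of `q_{t+1}`, and `Σ x_k = 0`** (`a ≡ 0`, `b > 0`). [Chihara Ch. I §4; this file, §1105] -/
theorem symmetric_recurrence_zeros_symm {q : ℕ → ℝ[X]} {a b : ℕ → ℝ} (hq0 : q 0 = 1) (hq1 : q 1 = Polynomial.X - C (a 0))
    (hrec : ∀ n, q (n + 2) = (Polynomial.X - C (a (n + 1))) * q (n + 1) - C (b (n + 1)) * q n) (ha : ∀ n, a n = 0)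
    {t : ℕ} {x : Fin (t + 1) → ℝ} (hx : StrictMono x) (hxq : q (t + 1) = ∏ k, (Polynomial.X - C (x k))) :
    (∀ k, x k = -x (Fin.rev k)) ∧ ∑ k, x k = 0 := by
  obtain ⟨hmono, hprod⟩ := recurrence_reflect_zeros hq0 hq1 hrec hq0 (by rw [hq1, ha 0, neg_zero]) (fun n => by rw [hrec n, ha (n + 1), neg_zero]) hx hxq
  have heq : x = fun k => -x (Fin.rev k) := strictMono_eq_of_prod_X_sub_C_eq hx hmono (hxq.symm.trans hprod)
  refine ⟨fun k => congr_fun heq k, ?_⟩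
  rw [sum_recurrence_zeros hq0 hq1 hrec hxq]
  exact Finset.sum_eq_zero fun i _ => ha i

/-- **For an odd number of zeros the middle one vanishes: `t = 2s` ⇒ `x_s = 0`.** [this file, §1105] -/
theorem symmetric_recurrence_middle_zero {q : ℕ → ℝ[X]} {a b : ℕ → ℝ} (hq0 : q 0 = 1) (hq1 : q 1 = Polynomial.X - C (a 0))
    (hrec : ∀ n, q (n + 2) = (Polynomial.X - C (a (n + 1))) * q (n + 1) - C (b (n + 1)) * q n) (ha : ∀ n, a n = 0)
    {s : ℕ} {x : Fin (2 * s + 1) → ℝ} (hx : StrictMono x) (hxq : q (2 * s + 1) = ∏ k, (Polynomial.X - C (x k))) :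
    x ⟨s, by omega⟩ = 0 := by
  have h := (symmetric_recurrence_zeros_symm hq0 hq1 hrec ha hx hxq).1 ⟨s, by omega⟩
  have hrev : Fin.rev (⟨s, by omega⟩ : Fin (2 * s + 1)) = ⟨s, by omega⟩ := by
    ext; rw [Fin.val_rev, Fin.val_mk]; omega
  rw [hrev] at h
  linarith

end Summit.Ventures.HSemireg.Wedge.HankelOuter
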